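import Summits.BirchSwinnertonDyer.BirchSwinnertonDyer.Theorems.GenusKolyvaginAtTwoMinimalTwinBSDTwoSwappedPairOneBitDescent
import HarnessLib

/-!
# Route `GenusKolyvaginAtTwo`, crux U₂ `MinimalTwinBSDTwo` (stmt-BirchSwinnertonDyer-22985), LINE 23 «twin_swap»: THE SWAPPED EXACT DESCENT AT
# ARBITRARY Ш-DEPTH — sign-free, Tamagawa-free: `BSD₂(Wd) → BSD₂(W)` from `2^{M₀} ∥ P(1)` and `#Ш(W_K)[2^∞] · 4^{ord₂ c + ord₂ C(W)} = 4^{M₀}`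
# (the engine the IDENTITY-PRIME DOOR consumes on the `Δ > 0` identity locus, where `Ш(W_K)[2^∞] ≠ 0`)

Seat `bsd-line-gk2-p2` g26 (PROVER seat 2/3, cell `bsd-f1-sign2`, LINE 23 holder), `--supports stmt-BirchSwinnertonDyer-22985` (helper; closes nothing).
THEOREMS ONLY (no definition, no named fact, no `sorry`); standard axioms.  **BSD is NOT proved by this file; U₂ is NOT proved; nothing is closed.**
CONDITIONAL (D-0014) on the four STATEMENT-ONLY published facts the route carries as items — Gross–Zagier at every level (`gross_zagier`, 24148),
Gross–Zagier–Kolyvagin (`rank_eq_analyticRank_of_analyticRank_le_one`, 19921), modularity (`hasEntireLFunction_rat`, 19273), Milne 1972 any-model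
(`Milne1972.bsdQuotient_baseChange_quadratic_anyModel`, 24149) — exactly as gk2-p3 g28's `OneBit.swappedPairDescentAtTwo_tamagawaDepth_of_facts`
(p766610…), whose §0 this file re-runs WITHOUT the sandwich.

WHY.  The cell's two reversed-twin descent engines (`OneBit…` on `Δ < 0` at one Tamagawa bit, `Silent…` on the egg at zero bits) both prove
`Ш(W_K)[2^∞] = 0` from a sandwich and then read Gross–Zagier over `K` as «`ord₂ I = ord₂ c + ord₂ C(W)`».  On the `Δ > 0` IDENTITY LOCUS the reversed
`2`-Selmer-trivial twin lives at an IDENTITY prime `ℓ` (two bits, `…IdentityDoor`), and there `Ш(W_K)[2]` is NOT zero (the ∞-relaxed classes of `W`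
become Selmer over `K = ℚ(√−ℓ)`: the ramified place imposes no condition on unramified classes) — BSD predicts `#Ш(W_K)[2^∞] = 4`.  So the honest
exponent statement on that locus is KOLYVAGIN-EXACTNESS-SHAPED: `#Ш(W_K)[2^∞] · 4^{ord₂ c + ord₂ C(W)} = 4^{M₀}` for the exact `2`-divisibility depth
`M₀` of `P(1)`.  This file proves the corresponding descent, for EVERY sign and EVERY Tamagawa budget:

* §1 `padicValRat_shaAnOverC_of_swappedPair` — gk2-p3's §0 WITHOUT the sandwich: for `W` globally minimal with `r_an = 1`, `#Sel₂(W) = 2` (any `Δ`,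
  any `C(W)`), `K` imaginary quadratic (`d_K` odd `≠ −3`, Heegner), any datum (`c ≠ 0`), `2^{M₀} ∥ P(1)`, and a globally minimal `2`-Selmer-trivial twin
  `Wd`: `r_an(Wd) = 0`, `r_an(W_K) = 1`, `Ш(W_K)` finite and `#Ш_an(W_K)/… = q` with **`ord₂ q = 2M₀ − 2 ord₂ c − 2 ord₂ C(W)`** (Gross–Zagier over `K`,
  `w_K = 2`, `C(W/K) = C(W)²`, McCallum 5.1).
* §2 **`swappedPairDescentAtTwo_shaDepth_of_facts`** — add `#Ш(W_K)[2^∞] · 2^{2(ord₂ c + ord₂ C(W))} = 2^{2M₀}`: then **`BSD₂(Wd) → BSD₂(W)`**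
  (`MissingPPartOverCAt (W ⊗ K) 2`, then `AdditivePotMult.bsdp_of_pPartOverC_baseChange`).  At `#Ш(W_K)[2^∞] = 1` this is the OneBit / Silent engine.
* §3 `natCard_sha_mul_eq_of_bsdp` — LOSSLESSNESS: `BSD₂(W) ∧ BSD₂(Wd)` + PRINT force the relation (for the exact `M₀`).

References: [GrossZagier1986] I.(6.3), V.§2 (2.2); [GrossLMS1991] §2 (2.2)–(2.3), §5 Prop. 5.3; [McCallumLMS1991] §5 Lemma 5.1; [Milne1972ArithmeticAV]
§1 Thm. 1; [Kolyvagin1989Izv] Thm. A; [Miller2011LMS] Def. 1.1.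
-/

set_option autoImplicit false
set_option linter.dupNamespace false -- `Summit.<P>.<Sub>` repeats `BirchSwinnertonDyer` (D-0017)

noncomputable section

open scoped Classical

open WeierstrassCurve NumberField Literature.NumberTheory.EllipticCurves
  Literature.NumberTheory.EllipticCurves.ModularForms
  Literature.NumberTheory.EllipticCurves.Rank1Residual
  Literature.NumberTheory.EllipticCurves.Rank1Residual.Typed
  Literature.NumberTheory.EllipticCurves.KrizLi2019
  Summit.BirchSwinnertonDyer.Rank1Residual
  Summit.BirchSwinnertonDyer.Rank1Residual.AdditivePotMult
  Summit.BirchSwinnertonDyer.BirchSwinnertonDyer.Rank1Residual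
  Summit.BirchSwinnertonDyer.BirchSwinnertonDyer.Theorems.CMExactDescent
  Summit.BirchSwinnertonDyer.BirchSwinnertonDyer.Theorems.GenusExact.TwinSwap

namespace Summit.BirchSwinnertonDyer.BirchSwinnertonDyer.Theorems.GenusExact.TwinSwap.IdentityDoor

/-! ## §1 Gross–Zagier over `K` on the swapped frame, no sandwich: `ord₂ #Ш_an(W_K) = 2M₀ − 2 ord₂ c − 2 ord₂ C(W)` -/

/-- **The `2`-adic Gross–Zagier bookkeeping of the swapped frame, sign-free and budget-free.**  `W/ℚ` globally minimal with `r_an(W) = 1`, `#Sel₂(W) = 2`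
(any sign of `Δ`, any `C(W)`); `K` imaginary quadratic, `d_K` odd `≠ −3`, Heegner for `N_W`; any datum `Dt` (`c ≠ 0`); `d₁` conductor-`1` with `2^{M₀} ∥ P(1)`
in `W(K[1])`; `Wd` a globally minimal `2`-Selmer-trivial twin; PRINT `hGZ` (for `(N_W, W, K)`), `hGZK`, `hmod`.  Then `r_an(Wd) = 0`, `r_an(W_K) = 1`, `Ш(W_K)`
is finite, and `#Ш_an(W_K) = q` with **`ord₂ q = 2 M₀ − 2 ord₂ c − 2 ord₂ C(W)`** (`q = 4I²/(c² w_K² C(W)²)`, `w_K = 2`, `ord₂ I = M₀` by McCallum 5.1 over `K`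
after Galois descent `K[1] → K`).  gk2-p3 g28's `OneBit.padicValRat_shaAn_and_shaOrder_of_swappedPair_of_le_succ` with the sandwich conjunct removed.
[cite: GrossZagier1986, V.§2 (2.2)] [cite: McCallumLMS1991, §5 Lemma 5.1] [cite: GrossLMS1991, §2 (2.3)] -/
theorem padicValRat_shaAnOverC_of_swappedPair
    (W : WeierstrassCurve ℚ) [W.IsElliptic] [W.IsGloballyMinimal] [NeZero (W.conductorNorm ℤ)]
    (K : Type) [Field K] [NumberField K]
    (hGZ : gross_zagier (W.conductorNorm ℤ) W K) (hGZK : rank_eq_analyticRank_of_analyticRank_le_one) (hmod : hasEntireLFunction_rat)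
    (hr : W.analyticRank = 1) (hSel : Nat.card (W.selmerGroup 2) = 2)
    (hK : IsImaginaryQuadratic K) (hodd : Odd (NumberField.discr K)) (h3 : NumberField.discr K ≠ -3)
    (hH : SatisfiesHeegnerHypothesis (W.conductorNorm ℤ) K)
    (Dt : ModularParametrizationData W (W.conductorNorm ℤ)) (hc0 : Dt.c ≠ 0) (β : ℤ) (ι : K →+* ℂ)
    (d₁ : KolyvaginHeegnerData Dt β ι 1) (hy : ¬ IsOfFinAddOrder d₁.derivedPoint) {M₀ : ℕ}
    (hdiv : ∃ Q : (W.baseChange (ringClassField K ι 1)).toAffine.Point, ((2 ^ M₀ : ℕ) : ℤ) • Q = d₁.derivedPoint)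
    (hndiv : ¬ ∃ Q : (W.baseChange (ringClassField K ι 1)).toAffine.Point, ((2 ^ (M₀ + 1) : ℕ) : ℤ) • Q = d₁.derivedPoint)
    (Wd : WeierstrassCurve ℚ) [Wd.IsElliptic] [Wd.IsGloballyMinimal]
    (Cd : VariableChange ℚ) (hCd : Cd • W.quadraticTwist (NumberField.discr K : ℚ) = Wd)
    (hSel1 : Nat.card (Wd.selmerGroup 2) = 1) :
    Wd.analyticRank = 0 ∧ (W.baseChange K).analyticRank = 1 ∧ Finite (W.baseChange K).sha ∧
      ∃ q : ℚ, shaAnOverC (W.baseChange K) = (q : ℂ) ∧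
        padicValRat 2 q = 2 * (M₀ : ℤ) - 2 * (padicValInt 2 Dt.c : ℤ) - 2 * (padicValNat 2 W.tamagawaProduct : ℤ) := by
  haveI : Fact (Nat.Prime 2) := ⟨Nat.prime_two⟩
  haveI hEK : (W.baseChange K).IsElliptic := isElliptic_baseChange' W K
  have h2 : Module.finrank ℚ K = 2 := hK.1
  have hD0 : (NumberField.discr K : ℚ) ≠ 0 := by exact_mod_cast NumberField.discr_ne_zero K
  haveI hEt : (W.quadraticTwist (NumberField.discr K : ℚ)).IsElliptic := W.isElliptic_quadraticTwist hD0
  obtain ⟨-, hDlt⟩ := discr_emod_four_and_lt_of_odd hK hodd h3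
  have hw2 : Units.torsionOrder K = 2 :=
    Literature.NumberTheory.QuadraticFields.Quadratic.torsionOrder_eq_two_of_discr_lt_neg_four h2 hDlt
  -- the Heegner point `P₀ ∈ E(K)` below `P(1)`
  obtain ⟨P₀, Hd, hP₀, hP₀K⟩ := exists_heegnerPoint_map_eq_derivedPoint_one hK hH d₁
  have hPinf : ¬ IsOfFinAddOrder P₀ := by
    intro hfin
    apply hy
    rw [← hP₀K]
    exact (WeierstrassCurve.Affine.Point.map (W' := W)
      (algebraMap K (ringClassField K ι 1)).toRatAlgHom).isOfFinAddOrder hfin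
  -- ranks over `ℚ`: `rank E(K) ≥ 1`, `rank E^(d_K)(ℚ) = 0`, hence `rank E(ℚ) ≥ 1`
  haveI : Module.Finite ℤ (W.baseChange K).toAffine.Point := (W.baseChange K).module_finite_point_holds
  have hK1 : 1 ≤ (W.baseChange K).mordellWeilRank :=
    Literature.NumberTheory.EllipticCurves.one_le_mordellWeilRank_of_not_isOfFinAddOrder (W.baseChange K) inferInstance hPinf
  have hSelT : Nat.card ((W.quadraticTwist (NumberField.discr K : ℚ)).selmerGroup ((2 : ℕ) : ℤ)) = 1 := by
    have h := natCard_selmerGroup_smul (W.quadraticTwist (NumberField.discr K : ℚ)) Cd (n := 2) two_ne_zero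
    rw [hCd] at h
    rw [← h, Nat.cast_ofNat]
    exact hSel1
  obtain ⟨hrkT0, -, -⟩ := rank_eq_zero_and_torsionBy_eq_bot_and_sha_inf_torsionBy_eq_bot_of_natCard_selmerGroup_eq_one
    (W.quadraticTwist (NumberField.discr K : ℚ)) 2 hSelT
  have hrk : 1 ≤ W.mordellWeilRank := by
    have hsum := W.mordellWeilRank_baseChange_of_finrank_eq_two_of_finite K h2
    rw [hrkT0, add_zero] at hsum
    rw [← hsum]
    exact hK1
  -- `E(ℚ)[2] = 0`, hence `E(K[1])[2^M] = 0` and `E(K)[2] = 0`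
  obtain ⟨-, hT2, -⟩ := rank_eq_one_and_sha_primary_eq_zero_of_natCard_selmerGroup_eq_two W hSel hrk
  have hT2' : ∀ P : W.toAffine.Point, 2 • P = 0 → P = 0 := fun P hP ↦ by convert hT2 P (by convert hP)
  have htor1 : ∀ (M : ℕ) (R : (W.baseChange (ringClassField K ι 1)).toAffine.Point),
      ((2 ^ M : ℕ) : ℤ) • R = 0 → R = 0 :=
    fun M R hR ↦ eq_zero_of_two_pow_smul_eq_zero_ringClassField_of_noTwoTorsion W hK hodd hH hT2' ι M R hR
  have hiv : ∀ x : (W.baseChange K).toAffine.Point, 2 • x = 0 → x = 0 := fun x hx ↦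
    forall_two_zsmul_baseChange_eq_zero_of_heegner W K hK hodd hH hT2' x (by rw [← natCast_zsmul] at hx; exact_mod_cast hx)
  -- analytic ranks
  have hrt : (W.quadraticTwist (NumberField.discr K : ℚ)).analyticRank = 0 :=
    analyticRank_twist_eq_zero_of_rankOne W K hGZ hmod hK hH hr ⟨Dt, Hd, ι, hP₀⟩ hPinf
  have hrd : Wd.analyticRank = 0 := by rw [← hCd, analyticRank_smul, hrt]
  have hrK : (W.baseChange K).analyticRank = 1 :=
    (P2.analyticRank_baseChange_eq_one_iff W K hmod h2).mpr (Or.inl ⟨hr, hrt⟩)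
  -- Gross–Zagier over `K`
  obtain ⟨hrkK, hShaK, -, hshaC⟩ := shaAnOverC_baseChange_eq_of_heegner W K Dt Hd ι P₀ hGZ hGZK hmod hK hH hP₀ hc0 hrK
  haveI hfinK : Finite (W.baseChange K).sha := hShaK
  -- `ord₂ [E(K) : ℤP₀] = M₀`
  have hdivK : ∃ Q : (W.baseChange K).toAffine.Point, ((2 ^ M₀ : ℕ) : ℤ) • Q = P₀ :=
    (X11b.Three.Koly.pDiv_one_iff_exists_zsmul_eq hK d₁ P₀ hP₀K 2 M₀ (htor1 M₀)).mp hdiv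
  have hndivK : ¬ ∃ Q : (W.baseChange K).toAffine.Point, ((2 ^ (M₀ + 1) : ℕ) : ℤ) • Q = P₀ :=
    fun h ↦ hndiv ((X11b.Three.Koly.pDiv_one_iff_exists_zsmul_eq hK d₁ P₀ hP₀K 2 (M₀ + 1) (htor1 (M₀ + 1))).mpr h)
  haveI : Finite (AddCommGroup.torsion (W.baseChange K).toAffine.Point) :=
    WeierstrassCurve.finite_torsion_point (W := W.baseChange K)
  obtain ⟨cc, Q, hcQ, hcker⟩ := X11b.RankOne.exists_coord_of_mordellWeilRank_eq_one (W.baseChange K) hrkK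
  have hidx : padicValNat 2 (AddSubgroup.zmultiples P₀).index = M₀ :=
    X11b.Three.Koly.padicValNat_index_zmultiples_eq_of_divisibility (p := 2) cc Q hcQ hcker hiv P₀ hdivK hndivK
  set I := (AddSubgroup.zmultiples P₀).index with hI_def
  have hI0 : I ≠ 0 := fun hI ↦ by
    have hh := P2.torsionOrder_sq_mul_canonicalHeight_eq_index_sq_mul_regulator (W.baseChange K) hrkK P₀ hPinf
    rw [← hI_def, hI, Nat.cast_zero, zero_pow two_ne_zero, zero_mul, mul_eq_zero, pow_eq_zero_iff two_ne_zero,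
      Nat.cast_eq_zero] at hh
    exact hh.elim (W.baseChange K).torsionOrder_pos_holds.ne'
      (fun h0 ↦ hPinf ((Affine.Point.canonicalHeight_eq_zero_iff_holds P₀).mp h0))
  set q : ℚ := 4 * (I : ℚ) ^ 2 /
      ((Dt.c : ℚ) ^ 2 * (Units.torsionOrder K : ℚ) ^ 2 * ((W.tamagawaProduct : ℚ) ^ 2)) with hq_def
  have hcQ0 : (Dt.c : ℚ) ≠ 0 := by exact_mod_cast hc0
  have hcW0 : (W.tamagawaProduct : ℚ) ≠ 0 := by exact_mod_cast W.tamagawaProduct_pos_holds.ne'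
  have hIQ0 : (I : ℚ) ≠ 0 := by exact_mod_cast hI0
  have hq' : q = ((I : ℚ) / ((Dt.c : ℚ) * (W.tamagawaProduct : ℚ))) ^ 2 := by
    rw [hq_def, hw2]
    push_cast
    field_simp
    ring
  have hvc : padicValRat 2 (Dt.c : ℚ) = padicValInt 2 Dt.c := padicValRat.of_int
  have hval : padicValRat 2 q = 2 * (M₀ : ℤ) - 2 * (padicValInt 2 Dt.c : ℤ) - 2 * (padicValNat 2 W.tamagawaProduct : ℤ) := by
    rw [hq', padicValRat.pow, padicValRat.div hIQ0 (mul_ne_zero hcQ0 hcW0),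
      padicValRat.mul hcQ0 hcW0, hvc, padicValRat.of_nat, padicValRat.of_nat, hidx]
    push_cast
    ring
  exact ⟨hrd, hrK, hShaK, q, hshaC, hval⟩

/-! ## §2 The swapped exact descent at Ш-depth `M₀ − ord₂ c − ord₂ C(W)` -/

/-- **THE SWAPPED EXACT DESCENT AT ARBITRARY Ш-DEPTH, MODULO ITS FOUR PUBLISHED INPUTS** `hGZ` (Gross–Zagier, all `(N, W, K)`), `hGZK`, `hmod`, `hMilneC`.
For the rank-ONE `2`-Selmer-minimal member `W` (`r_an(W) = 1`, `#Sel₂(W) = 2`; ANY sign of `Δ`, ANY `C(W)`), a Heegner field `K` (`d_K` odd `≠ −3`), ANY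
datum `Dt` (`c ≠ 0`), `P(1)` of infinite order with `2^{M₀} ∥ P(1)` in `W(K[1])`, the KOLYVAGIN-EXACTNESS-SHAPED input
**`#Ш(W_K)[2^∞] · 2^{2(ord₂ c + ord₂ C(W))} = 2^{2 M₀}`**, and a globally minimal `2`-Selmer-TRIVIAL twin `Wd ≅ W^{(d_K)}` (ANY Tamagawa budget):
**`BSD₂(Wd) → BSD₂(W)`**.  Inside: §1 gives `ord₂ #Ш_an(W_K) = 2M₀ − 2 ord₂ c − 2 ord₂ C(W) = ord₂ #Ш(W_K)`, i.e. `MissingPPartOverCAt (W ⊗ K) 2`;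
`r_an(Wd) = 0`; then `AdditivePotMult.bsdp_of_pPartOverC_baseChange`.  At `#Ш(W_K)[2^∞] = 1` (so `M₀ = ord₂ c + ord₂ C(W)`) this is gk2-p3's OneBit
engine (`Δ < 0`, one bit) and the Silent engine (egg, no bit) with their sandwiches factored OUT; on the `Δ > 0` identity locus it is the engine of
the identity-prime door (two bits, `#Ш(W_K)[2^∞] = 4` predicted).  CONDITIONAL on the four named facts; closes nothing by itself.
[cite: GrossZagier1986, V.§2 (pp. 310–312)] [cite: GrossLMS1991, §2 (2.3), §5 Prop. 5.3] [cite: Milne1972ArithmeticAV, §1 Thm. 1]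
[cite: McCallumLMS1991, §5 Lemma 5.1] [cite: Kolyvagin1989Izv, Thm. A] [cite: Miller2011LMS, Def. 1.1] -/
theorem swappedPairDescentAtTwo_shaDepth_of_facts
    (hGZ : ∀ (N : ℕ) [NeZero N] (W : WeierstrassCurve ℚ) (K : Type) [Field K] [NumberField K],
      gross_zagier N W K)
    (hGZK : rank_eq_analyticRank_of_analyticRank_le_one) (hmod : hasEntireLFunction_rat)
    (hMilneC : Milne1972.bsdQuotient_baseChange_quadratic_anyModel) :
    ∀ (W : WeierstrassCurve ℚ) [W.IsElliptic] [W.IsGloballyMinimal] [NeZero (W.conductorNorm ℤ)],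
      W.analyticRank = 1 → Nat.card (W.selmerGroup 2) = 2 →
      ∀ (K : Type) [Field K] [NumberField K], IsImaginaryQuadratic K → Odd (NumberField.discr K) →
      NumberField.discr K ≠ -3 → SatisfiesHeegnerHypothesis (W.conductorNorm ℤ) K →
      ∀ (Dt : ModularParametrizationData W (W.conductorNorm ℤ)), Dt.c ≠ 0 →
      ∀ (β : ℤ) (ι : K →+* ℂ) (d₁ : KolyvaginHeegnerData Dt β ι 1), ¬ IsOfFinAddOrder d₁.derivedPoint →
      ∀ (M₀ : ℕ),
        (∃ Q : (W.baseChange (ringClassField K ι 1)).toAffine.Point, ((2 ^ M₀ : ℕ) : ℤ) • Q = d₁.derivedPoint) →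
        (¬ ∃ Q : (W.baseChange (ringClassField K ι 1)).toAffine.Point, ((2 ^ (M₀ + 1) : ℕ) : ℤ) • Q = d₁.derivedPoint) →
        Nat.card (AddCommGroup.primaryComponent (W.baseChange K).sha 2) *
            2 ^ (2 * (padicValInt 2 Dt.c + padicValNat 2 W.tamagawaProduct)) = 2 ^ (2 * M₀) →
      ∀ (Wd : WeierstrassCurve ℚ) [Wd.IsElliptic] [Wd.IsGloballyMinimal],
        (∃ C : WeierstrassCurve.VariableChange ℚ, C • W.quadraticTwist (NumberField.discr K : ℚ) = Wd) →
        Nat.card (Wd.selmerGroup 2) = 1 →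
        BSDp Wd 2 → BSDp W 2 := by
  intro W _ _ _ hr hSel K _ _ hK hodd h3 hH Dt hc0 β ι d₁ hy M₀ hdiv hndiv hsha Wd _ _ hWd hSel1 hBd
  haveI : Fact (Nat.Prime 2) := ⟨Nat.prime_two⟩
  haveI hEK : (W.baseChange K).IsElliptic := isElliptic_baseChange' W K
  have h2 : Module.finrank ℚ K = 2 := hK.1
  obtain ⟨Cd, hCd⟩ := hWd
  obtain ⟨hrd, -, hShaK, q, hshaC, hval⟩ := padicValRat_shaAnOverC_of_swappedPair W K (hGZ _ W K) hGZK hmod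
    hr hSel hK hodd h3 hH Dt hc0 β ι d₁ hy hdiv hndiv Wd Cd hCd hSel1
  haveI : Finite (W.baseChange K).sha := hShaK
  -- `ord₂ #Ш(W_K) = 2M₀ − 2e` from the exactness-shaped input
  have hcard_pos : 0 < Nat.card (AddCommGroup.primaryComponent (W.baseChange K).sha 2) := Nat.card_pos
  have hshaV : (padicValNat 2 (W.baseChange K).shaOrder : ℤ) =
      2 * (M₀ : ℤ) - 2 * (padicValInt 2 Dt.c : ℤ) - 2 * (padicValNat 2 W.tamagawaProduct : ℤ) := by
    rw [X11b.Three.Koly.padicValNat_shaOrder_eq (W.baseChange K) 2]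
    have h := congrArg (padicValNat 2) hsha
    rw [padicValNat.mul hcard_pos.ne' (pow_ne_zero _ two_ne_zero), padicValNat.prime_pow, padicValNat.prime_pow] at h
    omega
  have hKin : MissingPPartOverCAt (W.baseChange K) 2 := ⟨q, hshaC, by rw [hval, hshaV]⟩
  exact bsdp_of_pPartOverC_baseChange W 2 K Wd hGZK hmod hMilneC hr.le h2 ⟨Cd, hCd⟩
    (by rw [hrd]; exact zero_le_one) hKin hBd

/-! ## §3 Losslessness: the BSD pair forces `#Ш(W_K)[2^∞] · 4^{ord₂ c + ord₂ C(W)} = 4^{M₀}` -/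

/-- **`BSD₂(W) ∧ BSD₂(Wd)` + PRINT force `#Ш(W_K)[2^∞] · 2^{2(ord₂ c + ord₂ C(W))} = 2^{2M₀}`** on the swapped frame of §1 with ANY exact exponent
`2^{M₀} ∥ P(1)` (any sign of `Δ`, any Tamagawa budget): `AdditivePotMult.missingPPartOverCAt_baseChange_iff_bsdp` (`.mpr`) turns the two `BSD₂` into
`ord₂ #Ш_an(W_K) = ord₂ #Ш(W_K)`, while `ord₂ #Ш_an(W_K) = 2M₀ − 2 ord₂ c − 2 ord₂ C(W)` (§1).  A losslessness statement: the exactness-shaped input of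
§2 carries no slack.  CONDITIONAL on the two `BSD₂` hypotheses and the four named facts; nothing about BSD is proved.
[cite: GrossZagier1986, V.§2 (2.2)] [cite: Milne1972ArithmeticAV, §1 Thm. 1] [cite: McCallumLMS1991, §5 Lemma 5.1] [cite: Miller2011LMS, Def. 1.1] -/
theorem natCard_sha_mul_eq_of_bsdp
    (W : WeierstrassCurve ℚ) [W.IsElliptic] [W.IsGloballyMinimal] [NeZero (W.conductorNorm ℤ)]
    (K : Type) [Field K] [NumberField K]
    (hGZ : gross_zagier (W.conductorNorm ℤ) W K) (hGZK : rank_eq_analyticRank_of_analyticRank_le_one)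
    (hmod : hasEntireLFunction_rat) (hMilneC : Milne1972.bsdQuotient_baseChange_quadratic_anyModel)
    (hr : W.analyticRank = 1) (hSel : Nat.card (W.selmerGroup 2) = 2)
    (hK : IsImaginaryQuadratic K) (hodd : Odd (NumberField.discr K)) (h3 : NumberField.discr K ≠ -3)
    (hH : SatisfiesHeegnerHypothesis (W.conductorNorm ℤ) K)
    (Dt : ModularParametrizationData W (W.conductorNorm ℤ)) (hc0 : Dt.c ≠ 0) (β : ℤ) (ι : K →+* ℂ)
    (d₁ : KolyvaginHeegnerData Dt β ι 1) (hy : ¬ IsOfFinAddOrder d₁.derivedPoint) {M₀ : ℕ}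
    (hdiv : ∃ Q : (W.baseChange (ringClassField K ι 1)).toAffine.Point, ((2 ^ M₀ : ℕ) : ℤ) • Q = d₁.derivedPoint)
    (hndiv : ¬ ∃ Q : (W.baseChange (ringClassField K ι 1)).toAffine.Point, ((2 ^ (M₀ + 1) : ℕ) : ℤ) • Q = d₁.derivedPoint)
    (Wd : WeierstrassCurve ℚ) [Wd.IsElliptic] [Wd.IsGloballyMinimal]
    (hWd : ∃ C : VariableChange ℚ, C • W.quadraticTwist (NumberField.discr K : ℚ) = Wd)
    (hSel1 : Nat.card (Wd.selmerGroup 2) = 1)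
    (hBW : BSDp W 2) (hBd : BSDp Wd 2) :
    Nat.card (AddCommGroup.primaryComponent (W.baseChange K).sha 2) *
        2 ^ (2 * (padicValInt 2 Dt.c + padicValNat 2 W.tamagawaProduct)) = 2 ^ (2 * M₀) := by
  haveI : Fact (Nat.Prime 2) := ⟨Nat.prime_two⟩
  haveI hEK : (W.baseChange K).IsElliptic := isElliptic_baseChange' W K
  have h2 : Module.finrank ℚ K = 2 := hK.1
  obtain ⟨Cd, hCd⟩ := hWd
  obtain ⟨hrd, -, hShaK, q, hshaC, hval⟩ := padicValRat_shaAnOverC_of_swappedPair W K hGZ hGZK hmod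
    hr hSel hK hodd h3 hH Dt hc0 β ι d₁ hy hdiv hndiv Wd Cd hCd hSel1
  haveI : Finite (W.baseChange K).sha := hShaK
  obtain ⟨q', hq', hv'⟩ :=
    (missingPPartOverCAt_baseChange_iff_bsdp W 2 K Wd hGZK hmod hMilneC (by rw [hr]) h2 ⟨Cd, hCd⟩
      (by rw [hrd]; exact zero_le_one) hBd).mpr hBW
  have hqq : q' = q := Rat.cast_injective (α := ℂ) (hq'.symm.trans hshaC)
  rw [hqq, hval, X11b.Three.Koly.padicValNat_shaOrder_eq (W.baseChange K) 2] at hv'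
  -- `#Ш(W_K)[2^∞] = 2^k` with `k = 2M₀ − 2 ord₂ c − 2 ord₂ C(W)`
  obtain ⟨k, hk⟩ := X11b.SelmerCount.exists_natCard_primaryComponent_eq_pow_of_finite 2 (G := (W.baseChange K).sha)
  rw [hk, padicValNat.prime_pow] at hv'
  have hk' : (k : ℤ) = 2 * (M₀ : ℤ) - 2 * (padicValInt 2 Dt.c : ℤ) - 2 * (padicValNat 2 W.tamagawaProduct : ℤ) := by
    exact_mod_cast hv'.symm
  have hkeq : k + 2 * (padicValInt 2 Dt.c + padicValNat 2 W.tamagawaProduct) = 2 * M₀ := by omega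
  rw [hk, ← pow_add, hkeq]

end Summit.BirchSwinnertonDyer.BirchSwinnertonDyer.Theorems.GenusExact.TwinSwap.IdentityDoor

end
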